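import Mathlib
import HarnessLib

/-!
# `DensityLadder.SeparatedTowerDensityLine` (item stmt-RiemannHypothesis-24918) — unit-window
# summation (infrastructure for steps (f), (g) of stub S1)

LINE L57 «sieve sight above the density line» (rh-idea-10 g1), crux K1 `SeparatedTowerDensityLine`,
stub S1 of the registered skeleton `Birth.lean` (seat memo `MEANVALUE-SECOND-READ.md` on
stmt-RiemannHypothesis-24918).  The tame zeros are controlled only through their unit-window masses
`Σ_{|γ_i − t| ≤ 1} m_i ≤ C log(|t|+2)`, the tower zeros through g-separation (`≤ ⌊1/g⌋ + 1`
ordinates per unit window).  Every estimate of a sum `Σ_i m_i h(γ_i)` over such a family is obtained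
by sorting the ordinates into the windows `[n, n+1)`, `n = ⌊γ_i⌋ ∈ ℤ`: this file proves the generic
inequality `Σ_{i∈A} m_i h(γ_i) ≤ Σ_n w(n) H(n)` for a finite family `A` with window masses `≤ w(n)`
and `h ≤ H(n)` on the window `n` (`Finset.sum_fiberwise`), together with the two window-mass facts
used by the line: the K1 tame hypothesis gives `w(n) = C log(|n|+2)`, and g-separation gives
`w(n) = B(1/g + 1)` for the tower.
Cell rh-split, seat rh-split-prover-l57 g0.  RH-free, ζ-free; FRONTIER bookkeeping; nothing here
bears on the truth of RH.
-/

set_option linter.dupNamespace false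

noncomputable section

open Filter Set Topology

namespace Summit.RiemannHypothesis.RiemannHypothesis.Theorems.DensityLadderSeparatedTowerWindows

/-- **Unit-window summation.** Let `A` be a finite family with ordinates `γ_i`, weights
`m_i ≥ 0`, window masses `Σ_{i ∈ A, ⌊γ_i⌋ = n} m_i ≤ w(n)`, and let `h(γ_i) ≤ H(⌊γ_i⌋)` with
`H ≥ 0`.  If the windows of `A` lie in the finite set `S ⊆ ℤ`, then
`Σ_{i∈A} m_i h(γ_i) ≤ Σ_{n∈S} w(n) H(n)`. [folklore] -/
theorem sum_window_le {ι : Type} (A : Finset ι) (γ : ι → ℝ) (m : ι → ℝ) (hm : ∀ i ∈ A, 0 ≤ m i)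
    (h : ℝ → ℝ) (H : ℤ → ℝ) (hH0 : ∀ n, 0 ≤ H n) (hH : ∀ i ∈ A, h (γ i) ≤ H ⌊γ i⌋)
    (w : ℤ → ℝ) (hw : ∀ n : ℤ, ∑ i ∈ A.filter (fun i ↦ ⌊γ i⌋ = n), m i ≤ w n)
    (S : Finset ℤ) (hS : ∀ i ∈ A, ⌊γ i⌋ ∈ S) :
    ∑ i ∈ A, m i * h (γ i) ≤ ∑ n ∈ S, w n * H n := by
  classical
  calc ∑ i ∈ A, m i * h (γ i) ≤ ∑ i ∈ A, m i * H ⌊γ i⌋ :=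
        Finset.sum_le_sum fun i hi ↦ mul_le_mul_of_nonneg_left (hH i hi) (hm i hi)
    _ = ∑ n ∈ S, ∑ i ∈ A.filter (fun i ↦ ⌊γ i⌋ = n), m i * H ⌊γ i⌋ :=
        (Finset.sum_fiberwise_of_maps_to hS _).symm
    _ = ∑ n ∈ S, H n * ∑ i ∈ A.filter (fun i ↦ ⌊γ i⌋ = n), m i := by
        refine Finset.sum_congr rfl fun n _ ↦ ?_
        rw [Finset.mul_sum]
        refine Finset.sum_congr rfl fun i hi ↦ ?_
        rw [(Finset.mem_filter.1 hi).2, mul_comm]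
    _ ≤ ∑ n ∈ S, H n * w n :=
        Finset.sum_le_sum fun n _ ↦ mul_le_mul_of_nonneg_left (hw n) (hH0 n)
    _ = ∑ n ∈ S, w n * H n := Finset.sum_congr rfl fun n _ ↦ mul_comm _ _

/-- The windows of a family with `|γ_i| ≤ N` lie in `[-N-1, N] ∩ ℤ`. [folklore] -/
theorem floor_mem_Icc_of_abs_le {x : ℝ} {N : ℕ} (hx : |x| ≤ N) :
    ⌊x⌋ ∈ Finset.Icc (-(N : ℤ) - 1) N := by
  rw [Finset.mem_Icc]
  have h1 := abs_le.1 hx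
  constructor
  · have : (-(N : ℤ) - 1 : ℤ) = ⌊(-(N : ℝ) - 1)⌋ := by
      rw [show (-(N : ℝ) - 1) = ((-(N : ℤ) - 1 : ℤ) : ℝ) by push_cast; ring, Int.floor_intCast]
    rw [this]
    exact Int.floor_le_floor (by linarith)
  · exact Int.floor_le_iff.2 (by push_cast; linarith)

/-- **Tame window masses from the K1 hypothesis.** If every unit window has mass
`Σ_{|γ_i − t| ≤ 1} m_i ≤ C log(|t|+2)` (as a `finsum` over the finite window set), then for a finite
subfamily `A` of those indices the window `⌊γ_i⌋ = n` has mass `≤ C log(|n|+2)`. [folklore] -/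
theorem tame_window_mass_le {ι : Type} (γ : ι → ℝ) (m : ι → ℝ) (hm : ∀ i, 0 ≤ m i) (P : ι → Prop)
    {C : ℝ} (hwin : ∀ t : ℝ, {i : ι | P i ∧ |γ i - t| ≤ 1}.Finite ∧
      (∑ᶠ i ∈ {i : ι | P i ∧ |γ i - t| ≤ 1}, m i) ≤ C * Real.log (|t| + 2))
    (A : Finset ι) (hA : ∀ i ∈ A, P i) (n : ℤ) :
    ∑ i ∈ A.filter (fun i ↦ ⌊γ i⌋ = n), m i ≤ C * Real.log (|(n : ℝ)| + 2) := by
  classical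
  obtain ⟨hfin, hle⟩ := hwin n
  refine le_trans ?_ hle
  rw [finsum_mem_eq_finite_toFinset_sum _ hfin]
  refine Finset.sum_le_sum_of_subset_of_nonneg (fun i hi ↦ ?_) fun i _ _ ↦ hm i
  rw [Finset.mem_filter] at hi
  rw [Set.Finite.mem_toFinset, mem_setOf_eq]
  refine ⟨hA i hi.1, ?_⟩
  have h1 := Int.floor_le (γ i)
  have h2 := Int.lt_floor_add_one (γ i)
  rw [hi.2] at h1 h2
  rw [abs_le]; constructor <;> linarith

/-- **Tower window masses from g-separation.** If the ordinates of the indices satisfying `P` are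
pairwise `≥ g` apart (`g > 0`) and `m_i ≤ B` (`B ≥ 0`), then every window `⌊γ_i⌋ = n` of a finite
subfamily has mass `≤ B(1/g + 1)`. [folklore] -/
theorem tower_window_mass_le {ι : Type} (γ : ι → ℝ) (m : ι → ℝ) (P : ι → Prop)
    {g B : ℝ} (hg : 0 < g) (hB : 0 ≤ B) (hmB : ∀ i, P i → m i ≤ B)
    (hsep : ∀ i j : ι, P i → P j → i ≠ j → g ≤ |γ i - γ j|)
    (A : Finset ι) (hA : ∀ i ∈ A, P i) (n : ℤ) :
    ∑ i ∈ A.filter (fun i ↦ ⌊γ i⌋ = n), m i ≤ B * (1 / g + 1) := by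
  classical
  set F := A.filter (fun i ↦ ⌊γ i⌋ = n) with hF
  -- the window holds at most `1/g + 1` indices: inject into `ℕ` by `i ↦ ⌊(γ_i - n)/g⌋₊`
  have hcard : (F.card : ℝ) ≤ 1 / g + 1 := by
    set k : ι → ℕ := fun i ↦ ⌊(γ i - n) / g⌋₊ with hk
    have hmemF : ∀ i ∈ F, P i ∧ (n : ℝ) ≤ γ i ∧ γ i < n + 1 := by
      intro i hi
      rw [hF, Finset.mem_filter] at hi
      have h1 := Int.floor_le (γ i)
      have h2 := Int.lt_floor_add_one (γ i)
      rw [hi.2] at h1 h2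
      exact ⟨hA i hi.1, h1, h2⟩
    have hinj : Set.InjOn k F := by
      intro i hi j hj hij
      by_contra hne
      obtain ⟨hPi, hi1, _⟩ := hmemF i hi
      obtain ⟨hPj, hj1, _⟩ := hmemF j hj
      have hs := hsep i j hPi hPj hne
      have hyi : 0 ≤ (γ i - n) / g := div_nonneg (by linarith) hg.le
      have hyj : 0 ≤ (γ j - n) / g := div_nonneg (by linarith) hg.le
      rcases le_or_gt (γ i) (γ j) with hle | hlt
      · rw [abs_of_nonpos (by linarith)] at hs
        have h2 : (γ i - n) / g + 1 ≤ (γ j - n) / g := by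
          rw [div_add_one hg.ne', div_le_div_iff_of_pos_right hg]; linarith
        have h3 := Nat.floor_le_floor h2
        rw [Nat.floor_add_one hyi] at h3
        simp only [hk] at hij
        omega
      · rw [abs_of_pos (by linarith)] at hs
        have h2 : (γ j - n) / g + 1 ≤ (γ i - n) / g := by
          rw [div_add_one hg.ne', div_le_div_iff_of_pos_right hg]; linarith
        have h3 := Nat.floor_le_floor h2
        rw [Nat.floor_add_one hyj] at h3
        simp only [hk] at hij
        omega
    have himg : F.image k ⊆ Finset.range (⌊1 / g⌋₊ + 1) := by
      intro a ha
      rw [Finset.mem_image] at ha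
      obtain ⟨i, hi, rfl⟩ := ha
      obtain ⟨_, hi1, hi2⟩ := hmemF i hi
      rw [Finset.mem_range, Nat.lt_add_one_iff]
      refine Nat.floor_le_floor ?_
      rw [div_le_div_iff_of_pos_right hg]; linarith
    have h1 : F.card = (F.image k).card := (Finset.card_image_of_injOn hinj).symm
    have h2 := Finset.card_le_card himg
    rw [Finset.card_range] at h2
    have h3 : (⌊1 / g⌋₊ : ℝ) ≤ 1 / g := Nat.floor_le (by positivity)
    calc (F.card : ℝ) = ((F.image k).card : ℝ) := by rw [h1]
      _ ≤ ((⌊1 / g⌋₊ + 1 : ℕ) : ℝ) := by exact_mod_cast h2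
      _ ≤ 1 / g + 1 := by push_cast; linarith
  calc ∑ i ∈ F, m i ≤ ∑ i ∈ F, B := Finset.sum_le_sum fun i hi ↦
        hmB i ((Finset.mem_filter.1 (hF ▸ hi)).1 |> hA i)
    _ = F.card * B := by rw [Finset.sum_const, nsmul_eq_mul]
    _ ≤ (1 / g + 1) * B := mul_le_mul_of_nonneg_right hcard hB
    _ = B * (1 / g + 1) := mul_comm _ _

/-! ## Infinite families: window summation through finite partial sums -/

/-- **Unit-window summation for an infinite family** (via finite partial sums, no rearrangement):
let `P` select a subfamily whose every finite part has window masses `≤ w(n)` (`w ≥ 0`), let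
`0 ≤ h(γ_i) ≤ H(⌊γ_i⌋)` on it with `H ≥ 0`, and let `Σ_n w(n)H(n)` converge over `ℤ`.  Then
`i ↦ m_i h(γ_i)` (set to `0` off `P`) is summable and `Σ' ≤ Σ'_n w(n) H(n)`. [folklore] -/
theorem tsum_window_le {ι : Type} (γ : ι → ℝ) (m : ι → ℝ) (hm : ∀ i, 0 ≤ m i) (P : ι → Prop)
    [DecidablePred P] (h : ℝ → ℝ) (hh0 : ∀ s, 0 ≤ h s) (H : ℤ → ℝ) (hH0 : ∀ n, 0 ≤ H n)
    (hH : ∀ i, P i → h (γ i) ≤ H ⌊γ i⌋) (w : ℤ → ℝ) (hw0 : ∀ n, 0 ≤ w n)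
    (hw : ∀ (A : Finset ι), (∀ i ∈ A, P i) → ∀ n : ℤ, ∑ i ∈ A.filter (fun i ↦ ⌊γ i⌋ = n), m i ≤ w n)
    (hsum : Summable fun n : ℤ ↦ w n * H n) :
    Summable (fun i : ι ↦ if P i then m i * h (γ i) else 0) ∧
    ∑' i : ι, (if P i then m i * h (γ i) else 0) ≤ ∑' n : ℤ, w n * H n := by
  classical
  set f : ι → ℝ := fun i ↦ if P i then m i * h (γ i) else 0 with hf
  have hf0 : ∀ i, 0 ≤ f i := fun i ↦ by
    rw [hf]; simp only; split_ifs
    · exact mul_nonneg (hm i) (hh0 _)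
    · exact le_rfl
  -- every finite partial sum is bounded by the window sum
  have hpartial : ∀ u : Finset ι, ∑ i ∈ u, f i ≤ ∑' n : ℤ, w n * H n := by
    intro u
    set A := u.filter (fun i ↦ P i) with hA
    have hAP : ∀ i ∈ A, P i := fun i hi ↦ (Finset.mem_filter.1 hi).2
    have h1 : ∑ i ∈ u, f i = ∑ i ∈ A, m i * h (γ i) := by
      rw [hA, Finset.sum_filter]
    rw [h1]
    set S : Finset ℤ := A.image (fun i ↦ ⌊γ i⌋) with hS
    have hSmem : ∀ i ∈ A, ⌊γ i⌋ ∈ S := fun i hi ↦ Finset.mem_image_of_mem _ hi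
    calc ∑ i ∈ A, m i * h (γ i) ≤ ∑ n ∈ S, w n * H n :=
          sum_window_le A γ m (fun i _ ↦ hm i) h H hH0 (fun i hi ↦ hH i (hAP i hi)) w
            (hw A hAP) S hSmem
      _ ≤ ∑' n : ℤ, w n * H n :=
          hsum.sum_le_tsum S fun n _ ↦ mul_nonneg (hw0 n) (hH0 n)
  exact ⟨summable_of_sum_le hf0 hpartial, Real.tsum_le_of_sum_le hf0 hpartial⟩

end Summit.RiemannHypothesis.RiemannHypothesis.Theorems.DensityLadderSeparatedTowerWindows

end
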